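import Summits.AtomisticToContinuum.FouriersLaw.Theses.PhononMeanFreePath
import Summits.AtomisticToContinuum.FouriersLaw.Theorems.BoundaryKubo.Negative.LoadBearing
import Summits.AtomisticToContinuum.FouriersLaw.Theorems.PhononMeanFreePathBoundaryKuboGibbsTTCFAux2
import Summits.AtomisticToContinuum.FouriersLaw.Theorems.OddSectorIrreversibilityResponseDensityKernelContinuity
import Literature.MathematicalPhysics.KineticTheory.LangevinChainNoiseContinuity

/-!
# Continuity of the pinned-chain kernels in the two bath temperatures
(stub `stub_kernelContinuity` of line `gibbs-ttcf`, crux stmt-AtomisticToContinuum-11812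
`PhononMeanFreePath.BoundaryKubo`)

For the pinned chain `P = pinnedChain ω₂ lam β γ` (all four `> 0`) with `N + 1` sites, `s ≥ 0`, `z` and a
continuous observable `f` of polynomial growth `|f| ≤ C (1 + H)^k`, the map
`(T_L, T_R) ↦ ∫ f dK^{T_L,T_R}_s(z)` is continuous on `(0, ∞)²`, `K = OscillatorChain.transitionKernel` the
CONSTRUCTED kernels (`LangevinChainKernel.lean`).

Proof. `K^{a,b}_s(z)` is the law of `Φ_s(z, B) = chainFlow z η^{a,b}(B) s`, where the temperatures enter only
through the amplitudes `√(2γa), √(2γb)` of the noise path `η^{a,b} = chainNoise`, which is LINEAR in the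
amplitudes (`norm_chainNoise_sub_le` of `…ResponseDensityKernelContinuity`); the flow is continuous in the
noise path in the uniform norm on `[0, s]` (`pinnedChain_exists_norm_chainFlow_sub_lt`), so
`(a, b) ↦ Φ^{a,b}_s(z, B(ω))` is continuous for EVERY `ω` (`pinnedChain_continuous_solMap_temp`), and for
BOUNDED continuous `g` dominated convergence under `wienerPair` gives the continuity of
`(a, b) ↦ K^{a,b}_s g(z)` on all of `ℝ²` (`pinnedChain_continuous_integral_transitionKernel_temp`, the Feller
pattern of `pinnedChain_continuous_integral_transitionKernel`). For the polynomially bounded `f` we truncate,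
`f_R = max(-R, min(f, R))`, `|f - f_R| ≤ f²/R`, and (3.4)
(`pinnedChain_integrable_transitionKernel_of_abs_le_exp` with `(1 + H)^{2k} ≤ (2k)! θ^{-2k} e^{θ} e^{θH}`,
`θ = 1/(2 max(A, B))`) bounds `∫ f² dK^{a,b}_s(z)` uniformly for `0 < a < A`, `0 < b < B`: the kernel averages
of `f` are a LOCALLY UNIFORM limit on `(0,∞)²` of the continuous functions `(a, b) ↦ K^{a,b}_s f_R(z)`
(`TendstoLocallyUniformlyOn.continuousOn`).
-/

noncomputable section

open scoped NNReal ENNReal Topology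
open MeasureTheory Filter Set

namespace Summit.AtomisticToContinuum.FouriersLaw.Theorems.BoundaryKubo.GibbsTtcf

open Literature.MathematicalPhysics.KineticTheory.HeatConduction
open Literature.MathematicalPhysics.KineticTheory Literature.Probability.Process OscillatorChain
open ProbabilityTheory
open Summit.AtomisticToContinuum.FouriersLaw.Theorems.BoundaryKubo.Negative.LoadBearing
  (kuboIntegrand kuboValue LimitClause UniqueSteady SteadyFamily boundaryKubo_iff)

/-! ### Elementary inequalities: two-sided truncation and polynomial-versus-exponential growth -/

/-- The two-sided truncation `x ↦ max (-R) (min x R)` is bounded by `|R|`. [folklore] -/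
theorem abs_clamp_le (R x : ℝ) : |max (-R) (min x R)| ≤ |R| := by
  refine abs_le.2 ⟨?_, ?_⟩
  · exact (neg_le_neg (le_abs_self R)).trans (le_max_left _ _)
  · exact max_le (neg_le_abs R) ((min_le_right _ _).trans (le_abs_self R))

/-- Truncation error: `|x - max(-R, min(x, R))| ≤ x² / R` for `R > 0`. [folklore] -/
theorem abs_sub_clamp_le {R : ℝ} (hR : 0 < R) (x : ℝ) : |x - max (-R) (min x R)| ≤ x ^ 2 / R := by
  rw [le_div_iff₀ hR]
  rcases le_total x R with h1 | h1
  · rw [min_eq_left h1]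
    rcases le_total (-R) x with h2 | h2
    · rw [max_eq_right h2, sub_self, abs_zero, zero_mul]
      positivity
    · rw [max_eq_left h2, abs_of_nonpos (by linarith)]
      nlinarith [sq_nonneg (x + R), sq_nonneg x, sq_nonneg R]
  · rw [min_eq_right h1, max_eq_right (by linarith : -R ≤ R), abs_of_nonneg (by linarith)]
    nlinarith [sq_nonneg (x - R), sq_nonneg x, sq_nonneg R]

/-- Polynomial growth is dominated by exponential growth: `u^m ≤ (m!/θ^m) e^{θu}` for `u ≥ 0`,
`θ > 0` (`(θu)^m/m! ≤ e^{θu}`). [folklore] -/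
theorem pow_le_factorial_div_pow_mul_exp {u θ : ℝ} (hu : 0 ≤ u) (hθ : 0 < θ) (m : ℕ) :
    u ^ m ≤ m.factorial / θ ^ m * Real.exp (θ * u) := by
  have h := Real.pow_div_factorial_le_exp (θ * u) (by positivity) m
  rw [mul_pow, div_le_iff₀ (by positivity)] at h
  rw [div_mul_eq_mul_div, le_div_iff₀ (by positivity)]
  calc u ^ m * θ ^ m = θ ^ m * u ^ m := mul_comm _ _
    _ ≤ Real.exp (θ * u) * m.factorial := h
    _ = m.factorial * Real.exp (θ * u) := mul_comm _ _

/-! ### The flow and the solution map are continuous in the amplitudes / temperatures -/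

section Pinned

variable {ω₂ lam β γ : ℝ} (hω : 0 < ω₂) (hl : 0 ≤ lam) (hβ : 0 ≤ β) (hγ : 0 ≤ γ)
include hω hl hβ hγ

/-- **The flow is continuous in a parametrised noise path.** If the continuous noise paths `G c`
depend on a parameter `c` uniformly continuously at `c₀` in the sup norm on `[0, T]`, then
`c ↦ chainFlow x (G c) t` is continuous at `c₀` for `t ∈ [0, T]` (the `ε`-`δ` continuity of the flow in
the noise, `pinnedChain_exists_norm_chainFlow_sub_lt`, with the noise bound `M₀ + 1`, `M₀` a bound of
`G c₀` on `[0, T]`). [folklore] -/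
theorem pinnedChain_continuousAt_chainFlow_param (n : ℕ) (x : PhaseSpace n) {X : Type*}
    [TopologicalSpace X] {G : X → ℝ → Fin n → ℝ} (hG : ∀ c, Continuous (G c)) {T : ℝ} {c₀ : X}
    (hU : ∀ δ : ℝ, 0 < δ → ∀ᶠ c in 𝓝 c₀, ∀ t ∈ Icc 0 T, ‖G c t - G c₀ t‖ ≤ δ) {t : ℝ}
    (ht : t ∈ Icc 0 T) :
    ContinuousAt (fun c => (pinnedChain ω₂ lam β γ).chainFlow n x (G c) t) c₀ := by
  obtain ⟨M₀, -, hM⟩ := exists_noiseBound (hG c₀) T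
  rw [ContinuousAt, Metric.tendsto_nhds]
  intro ε hε
  obtain ⟨δ, hδ, hcont⟩ := pinnedChain_exists_norm_chainFlow_sub_lt hω hl hβ hγ n
    ((pinnedChain ω₂ lam β γ).hamiltonian n x) (M₀ + 1) T hε
  filter_upwards [hU (min δ 1) (lt_min hδ one_pos)] with c hc
  have hM₁ : ∀ u ∈ Icc 0 T, ‖G c u‖ ≤ M₀ + 1 := fun u hu => by
    have h1 := hM u hu
    have h2 := (hc u hu).trans (min_le_right _ _)
    calc ‖G c u‖ = ‖G c₀ u + (G c u - G c₀ u)‖ := by abel_nf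
      _ ≤ ‖G c₀ u‖ + ‖G c u - G c₀ u‖ := norm_add_le _ _
      _ ≤ M₀ + 1 := add_le_add h1 h2
  have hM₂ : ∀ u ∈ Icc 0 T, ‖G c₀ u‖ ≤ M₀ + 1 := fun u hu => (hM u hu).trans (by linarith)
  rw [dist_eq_norm]
  exact hcont x le_rfl (G c) (G c₀) (hG c) (hG c₀) hM₁ hM₂
    (fun u hu => (hc u hu).trans (min_le_left _ _)) t ht

/-- **The flow is continuous in the pair of noise amplitudes**, for every pair of raw driving paths
and every `t ≥ 0` (the noise is linear in the amplitudes with coefficients bounded on `[0, t]`). [folklore] -/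
theorem pinnedChain_continuous_chainFlow_chainNoise (n : ℕ) (x : PhaseSpace n) (w : WienerPair)
    {t : ℝ} (ht : 0 ≤ t) :
    Continuous fun c : ℝ × ℝ => (pinnedChain ω₂ lam β γ).chainFlow n x (chainNoise n c.1 c.2 w) t := by
  -- bounds of the two regularised driving paths on `[0, t]`
  obtain ⟨A₁, hA₁⟩ := isCompact_Icc.exists_bound_of_continuousOn
    (((continuous_pathRegularize_toNNReal (E := ℝ) w.1).sub continuous_const).continuousOn
      (s := Icc 0 t)) (f := fun u : ℝ => pathRegularize w.1 u.toNNReal - pathRegularize w.1 0)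
  obtain ⟨A₂, hA₂⟩ := isCompact_Icc.exists_bound_of_continuousOn
    (((continuous_pathRegularize_toNNReal (E := ℝ) w.2).sub continuous_const).continuousOn
      (s := Icc 0 t)) (f := fun u : ℝ => pathRegularize w.2 u.toNNReal - pathRegularize w.2 0)
  refine continuous_iff_continuousAt.2 fun c₀ => ?_
  refine pinnedChain_continuousAt_chainFlow_param hω hl hβ hγ n x (fun c => continuous_chainNoise _ _ w)
    (T := t) (fun δ hδ => ?_) ⟨ht, le_rfl⟩
  have hg : Tendsto (fun c : ℝ × ℝ => |c.1 - c₀.1| * |A₁| + |c.2 - c₀.2| * |A₂|) (𝓝 c₀) (𝓝 0) := by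
    have hc : Continuous fun c : ℝ × ℝ => |c.1 - c₀.1| * |A₁| + |c.2 - c₀.2| * |A₂| := by fun_prop
    simpa using hc.tendsto c₀
  filter_upwards [hg.eventually_lt_const hδ] with c hc u hu
  refine (norm_chainNoise_sub_le n _ _ _ _ w u).trans (le_of_lt (lt_of_le_of_lt ?_ hc))
  have h1 := hA₁ u hu
  have h2 := hA₂ u hu
  rw [Real.norm_eq_abs] at h1 h2
  exact add_le_add (mul_le_mul_of_nonneg_left (h1.trans (le_abs_self _)) (abs_nonneg _))
    (mul_le_mul_of_nonneg_left (h2.trans (le_abs_self _)) (abs_nonneg _))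

/-- **The solution map is continuous in the two bath temperatures**, for every pair of raw driving
paths, every initial condition and every `t ≥ 0` (the amplitudes `√(2γT_b)` are continuous in `T_b`).
[folklore] -/
theorem pinnedChain_continuous_solMap_temp (n : ℕ) {t : ℝ} (ht : 0 ≤ t) (x : PhaseSpace n)
    (w : WienerPair) :
    Continuous fun c : ℝ × ℝ => (pinnedChain ω₂ lam β γ).solMap n c.1 c.2 t x w := by
  have h1 : Continuous fun c : ℝ × ℝ =>
      (Real.sqrt (2 * (pinnedChain ω₂ lam β γ).γ * c.1),
        Real.sqrt (2 * (pinnedChain ω₂ lam β γ).γ * c.2)) := by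
    fun_prop
  have h2 := (pinnedChain_continuous_chainFlow_chainNoise hω hl hβ hγ n x w ht).comp h1
  unfold OscillatorChain.solMap
  exact h2

/-- **Continuity of the kernel averages of bounded continuous observables in the bath temperatures**,
on all of `ℝ²`: `(T_L, T_R) ↦ ∫ g dK^{T_L,T_R}_t(z) = E g(Φ^{T_L,T_R}_t(z, B))` is continuous for bounded
continuous `g` (pathwise continuity of the solution map in the temperatures and dominated convergence
under `wienerPair`; the Feller pattern of `pinnedChain_continuous_integral_transitionKernel`). [folklore] -/
theorem pinnedChain_continuous_integral_transitionKernel_temp (n : ℕ) (t : ℝ≥0) (z : PhaseSpace n)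
    {g : PhaseSpace n → ℝ} (hg : Continuous g) {R : ℝ} (hR : ∀ y, ‖g y‖ ≤ R) :
    Continuous fun c : ℝ × ℝ =>
      ∫ y, g y ∂((pinnedChain ω₂ lam β γ).transitionKernel n c.1 c.2 t z) := by
  have h : (fun c : ℝ × ℝ => ∫ y, g y ∂((pinnedChain ω₂ lam β γ).transitionKernel n c.1 c.2 t z)) =
      fun c => ∫ ω, g ((pinnedChain ω₂ lam β γ).solMap n c.1 c.2 t z (pairPath ω)) ∂wienerPair := by
    funext c
    exact pinnedChain_integral_transitionKernel hω hl hβ hγ n c.1 c.2 t z hg.aestronglyMeasurable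
  rw [h]
  refine continuous_of_dominated (bound := fun _ => R) (fun c => ?_) (fun c => ?_)
    (integrable_const R) ?_
  · exact (hg.measurable.comp
      (pinnedChain_measurable_solMap_pairPath_right hω hl hβ hγ n c.1 c.2 t z)).aestronglyMeasurable
  · exact Eventually.of_forall fun ω => hR _
  · exact Eventually.of_forall fun ω =>
      hg.comp (pinnedChain_continuous_solMap_temp hω hl hβ hγ n t.coe_nonneg z (pairPath ω))

/-- **A locally uniform second-moment bound along the kernels** from (3.4): for a continuous
`|f| ≤ C(1 + H)^k` and a box of temperatures `0 < a < A`, `0 < b < B` there is `K` with `f`, `f²`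
integrable for `K^{a,b}_s(z)` and `∫ f² dK^{a,b}_s(z) ≤ K` (`A > 0`; with `θ = 1/(2 max(A,B)) < 1/max(a,b)`:
`(1+H)^m ≤ m! θ^{-m} e^{θ} e^{θH}` and
`∫ e^{θH} dK^{a,b}_s(z) ≤ e^{θγ(a+b)s} e^{θH(z)} ≤ e^{θγ(A+B)s} e^{θH(z)}`).
[cite: CuneoEckmannHairerReyBellet2018, §3 eq. (3.4)] -/
theorem pinnedChain_integral_sq_transitionKernel_le (N : ℕ) (s : ℝ≥0) (z : PhaseSpace (N + 1))
    {f : PhaseSpace (N + 1) → ℝ} (hf : Continuous f) {C : ℝ} {k : ℕ}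
    (hCk : ∀ y, |f y| ≤ C * (1 + (pinnedChain ω₂ lam β γ).hamiltonian (N + 1) y) ^ k) {A : ℝ}
    (hA : 0 < A) (B : ℝ) :
    ∃ K : ℝ, ∀ a b : ℝ, 0 < a → a < A → 0 < b → b < B →
      Integrable f ((pinnedChain ω₂ lam β γ).transitionKernel (N + 1) a b s z) ∧
      Integrable (fun y => f y ^ 2) ((pinnedChain ω₂ lam β γ).transitionKernel (N + 1) a b s z) ∧
      ∫ y, f y ^ 2 ∂((pinnedChain ω₂ lam β γ).transitionKernel (N + 1) a b s z) ≤ K := by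
  set P := pinnedChain ω₂ lam β γ with hP
  have hmax : 0 < max A B := lt_max_of_lt_left hA
  set θ : ℝ := 1 / (2 * max A B) with hθdef
  have hθ : 0 < θ := by positivity
  have hH0 : ∀ y, 0 ≤ P.hamiltonian (N + 1) y := fun y =>
    pinnedChain_hamiltonian_nonneg hω.le hl hβ γ (N + 1) y
  have hC : 0 ≤ C := by
    have h := (abs_nonneg _).trans (hCk z)
    exact nonneg_of_mul_nonneg_left h (pow_pos (by linarith [hH0 z]) k)
  -- polynomial weights are dominated by the exponential weight `e^{θH}`
  have hb₁ : ∀ y, |f y| ≤ C * (k.factorial / θ ^ k * Real.exp θ) *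
      Real.exp (θ * P.hamiltonian (N + 1) y) := fun y => by
    have h1 := pow_le_factorial_div_pow_mul_exp
      (by linarith [hH0 y] : (0 : ℝ) ≤ 1 + P.hamiltonian (N + 1) y) hθ k
    rw [mul_add, mul_one, Real.exp_add] at h1
    calc |f y| ≤ C * (1 + P.hamiltonian (N + 1) y) ^ k := hCk y
      _ ≤ C * (k.factorial / θ ^ k * (Real.exp θ * Real.exp (θ * P.hamiltonian (N + 1) y))) :=
          mul_le_mul_of_nonneg_left h1 hC
      _ = _ := by ring
  have hb₂ : ∀ y, |f y ^ 2| ≤ C ^ 2 * ((2 * k).factorial / θ ^ (2 * k) * Real.exp θ) *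
      Real.exp (θ * P.hamiltonian (N + 1) y) := fun y => by
    have h1 := pow_le_factorial_div_pow_mul_exp
      (by linarith [hH0 y] : (0 : ℝ) ≤ 1 + P.hamiltonian (N + 1) y) hθ (2 * k)
    rw [mul_add, mul_one, Real.exp_add] at h1
    have h2 : |f y| ^ 2 ≤ (C * (1 + P.hamiltonian (N + 1) y) ^ k) ^ 2 :=
      pow_le_pow_left₀ (abs_nonneg _) (hCk y) 2
    calc |f y ^ 2| = |f y| ^ 2 := abs_pow _ _
      _ ≤ (C * (1 + P.hamiltonian (N + 1) y) ^ k) ^ 2 := h2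
      _ = C ^ 2 * (1 + P.hamiltonian (N + 1) y) ^ (2 * k) := by ring
      _ ≤ C ^ 2 * ((2 * k).factorial / θ ^ (2 * k) *
            (Real.exp θ * Real.exp (θ * P.hamiltonian (N + 1) y))) :=
          mul_le_mul_of_nonneg_left h1 (sq_nonneg C)
      _ = _ := by ring
  refine ⟨C ^ 2 * ((2 * k).factorial / θ ^ (2 * k) * Real.exp θ) *
    Real.exp (θ * γ * (A + B) * s) * Real.exp (θ * P.hamiltonian (N + 1) z),
    fun a b ha haA hb hbB => ?_⟩
  have hθ' : θ < 1 / max a b := by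
    rw [hθdef]
    refine one_div_lt_one_div_of_lt (lt_max_of_lt_left ha) ?_
    calc max a b ≤ max A B := max_le_max haA.le hbB.le
      _ < 2 * max A B := by linarith
  have h1 := pinnedChain_integrable_transitionKernel_of_abs_le_exp hω hl hβ hγ (Nat.succ_pos N) ha hb
    hθ hθ' hf hb₁ s z
  have h2 := pinnedChain_integrable_transitionKernel_of_abs_le_exp hω hl hβ hγ (Nat.succ_pos N) ha hb
    hθ hθ' (hf.pow 2) hb₂ s z
  refine ⟨h1.1, h2.1, ?_⟩
  have hab : θ * γ * (a + b) * s ≤ θ * γ * (A + B) * s :=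
    mul_le_mul_of_nonneg_right (mul_le_mul_of_nonneg_left (add_le_add haA.le hbB.le)
      (mul_nonneg hθ.le hγ)) s.coe_nonneg
  have hc₂ : 0 ≤ C ^ 2 * ((2 * k).factorial / θ ^ (2 * k) * Real.exp θ) := by positivity
  calc ∫ y, f y ^ 2 ∂(P.transitionKernel (N + 1) a b s z)
      = ∫ y, |f y ^ 2| ∂(P.transitionKernel (N + 1) a b s z) := by
        refine integral_congr_ae (Eventually.of_forall fun y => ?_)
        simp only [abs_pow, sq_abs]
    _ ≤ C ^ 2 * ((2 * k).factorial / θ ^ (2 * k) * Real.exp θ) * Real.exp (θ * γ * (a + b) * s) *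
          Real.exp (θ * P.hamiltonian (N + 1) z) := h2.2
    _ ≤ _ := mul_le_mul_of_nonneg_right (mul_le_mul_of_nonneg_left (Real.exp_le_exp.2 hab) hc₂)
          (Real.exp_pos _).le

end Pinned

/-! ### The stub -/

/-- **Joint continuity of the constructed kernels in the two bath temperatures** (stub
`stub_kernelContinuity` of line `gibbs-ttcf`): for the pinned chain with `N + 1` sites, `s ≥ 0`, `z`
and a continuous `|f| ≤ C(1 + H)^k`, `(T_L, T_R) ↦ ∫ f dK^{T_L,T_R}_s(z)` is continuous on `(0,∞)²`.
The truncated averages `(T_L,T_R) ↦ ∫ max(-R, min(f, R)) dK^{T_L,T_R}_s(z)` are continuous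
(`pinnedChain_continuous_integral_transitionKernel_temp`) and converge locally uniformly on `(0,∞)²`
as `R → ∞` (`|f - f_R| ≤ f²/R` and the locally uniform second-moment bound
`pinnedChain_integral_sq_transitionKernel_le` from (3.4)). [folklore] -/
theorem stub_kernelContinuity :
    ∀ ω₂ lam β γ : ℝ, 0 < ω₂ → 0 < lam → 0 < β → 0 < γ → ∀ (N : ℕ) (s : ℝ≥0) (z : PhaseSpace (N + 1))
      (f : PhaseSpace (N + 1) → ℝ), Continuous f →
      (∃ (C : ℝ) (k : ℕ), ∀ y, |f y| ≤ C * (1 + (pinnedChain ω₂ lam β γ).hamiltonian (N + 1) y) ^ k) →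
      ContinuousOn (fun TT : ℝ × ℝ =>
          ∫ y, f y ∂((pinnedChain ω₂ lam β γ).transitionKernel (N + 1) TT.1 TT.2 s z))
        (Set.Ioi (0 : ℝ) ×ˢ Set.Ioi (0 : ℝ)) := by
  intro ω₂ lam β γ hω hl hβ hγ N s z f hf hfb
  obtain ⟨C, k, hCk⟩ := hfb
  set P := pinnedChain ω₂ lam β γ with hP
  -- the truncated observables and their kernel averages, continuous on all of `ℝ²`
  set Ψ : ℝ → ℝ × ℝ → ℝ := fun R c =>
    ∫ y, max (-R) (min (f y) R) ∂(P.transitionKernel (N + 1) c.1 c.2 s z) with hΨ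
  have hΨc : ∀ R, Continuous (Ψ R) := fun R =>
    pinnedChain_continuous_integral_transitionKernel_temp hω hl.le hβ.le hγ.le (N + 1) s z
      (continuous_const.max (hf.min continuous_const))
      (fun y => by rw [Real.norm_eq_abs]; exact abs_clamp_le R (f y))
  have hlu : TendstoLocallyUniformlyOn Ψ
      (fun TT : ℝ × ℝ => ∫ y, f y ∂(P.transitionKernel (N + 1) TT.1 TT.2 s z)) atTop
      (Set.Ioi (0 : ℝ) ×ˢ Set.Ioi (0 : ℝ)) := by
    rw [Metric.tendstoLocallyUniformlyOn_iff]
    intro ε hε c₀ hc₀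
    rw [mem_prod, mem_Ioi, mem_Ioi] at hc₀
    -- a box of temperatures around `c₀`, bounded away from infinity
    have hA : 0 < c₀.1 + 1 := by linarith [hc₀.1]
    obtain ⟨K, hK⟩ :=
      pinnedChain_integral_sq_transitionKernel_le hω hl.le hβ.le hγ.le N s z hf hCk hA (c₀.2 + 1)
    refine ⟨(Ioi 0 ×ˢ Ioi 0) ∩ (Iio (c₀.1 + 1) ×ˢ Iio (c₀.2 + 1)),
      inter_mem self_mem_nhdsWithin (mem_nhdsWithin_of_mem_nhds
        ((isOpen_Iio.prod isOpen_Iio).mem_nhds ⟨by simp, by simp⟩)), ?_⟩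
    filter_upwards [eventually_gt_atTop (0 : ℝ), eventually_gt_atTop (K / ε)] with R hR0 hRK c hc
    simp only [mem_inter_iff, mem_prod, mem_Ioi, mem_Iio] at hc
    obtain ⟨⟨ha, hb⟩, haA, hbB⟩ := hc
    obtain ⟨hfi, hf2i, hf2⟩ := hK c.1 c.2 ha haA hb hbB
    set κ := P.transitionKernel (N + 1) c.1 c.2 s z with hκ
    haveI : IsProbabilityMeasure κ :=
      (pinnedChain_isMarkovKernel_transitionKernel hω hl.le hβ.le hγ.le (N + 1) c.1 c.2
        s).isProbabilityMeasure z
    have hgi : Integrable (fun y => max (-R) (min (f y) R)) κ :=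
      (integrable_const |R|).mono'
        (continuous_const.max (hf.min continuous_const)).aestronglyMeasurable
        (Eventually.of_forall fun y => by rw [Real.norm_eq_abs]; exact abs_clamp_le R (f y))
    have hKε : K < ε * R := by
      have := (div_lt_iff₀ hε).1 hRK
      linarith [mul_comm R ε]
    show dist (∫ y, f y ∂κ) (∫ y, max (-R) (min (f y) R) ∂κ) < ε
    rw [Real.dist_eq, ← integral_sub hfi hgi]
    calc |∫ y, (f y - max (-R) (min (f y) R)) ∂κ| ≤ ∫ y, |f y - max (-R) (min (f y) R)| ∂κ :=
          abs_integral_le_integral_abs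
      _ ≤ ∫ y, f y ^ 2 / R ∂κ :=
          integral_mono (hfi.sub hgi).abs (hf2i.div_const R) fun y => abs_sub_clamp_le hR0 (f y)
      _ = (∫ y, f y ^ 2 ∂κ) / R := integral_div R _
      _ ≤ K / R := div_le_div_of_nonneg_right hf2 hR0.le
      _ < ε := (div_lt_iff₀ hR0).2 hKε
  exact hlu.continuousOn (Frequently.of_forall fun R => (hΨc R).continuousOn)

end Summit.AtomisticToContinuum.FouriersLaw.Theorems.BoundaryKubo.GibbsTtcf

end
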